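import Literature.Claims.NS.Guevremont2026
import Mathlib.Analysis.Calculus.MeanValue
import HarnessLib

/-!
# Solo salvage for claim C143 `Guevremont2026` (cell `ns-claims`, D-0090): the ODE comparison of §4.2

Claim C143: skeleton `Literature.Claims.NS.Guevremont2026` (typist-4 g5, p524290). Its Step 4
(`Step4_Barrier R`, §4.2 p.5 l.67–74: «Standard ODE comparison shows sup_{t≥0} Ω(t) ≤ max(Ω(0), C²δ/4)»
for non-negative `Y` with `Y′ ≤ law R Y = C·Y√Y − Y²/δ` on `(0,T)`) is typed AS PRINTED. The right-hand
side `law R` changes sign at `Y = C²δ²`, not at the printed level `C²δ/4` (LOCATORS §4; typist's flag).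
This file records, Summits-side and records-grade (the located step of the verdict is untouched):

* `law_nonpos_of_ge` — `law R y ≤ 0` for `y ≥ C²δ²` (`y ≥ 0`);
* `le_max_of_deriv_right_nonpos_above` — the barrier principle behind «standard ODE comparison»: a
  function continuous on `[a,b]` whose right derivative is `≤ 0` wherever it exceeds `K` stays below
  `max (f a) K` (Mathlib `image_le_of_deriv_right_lt_deriv_boundary'` against affine barriers);
* `barrier_corrected` — the CORRECTED Step 4, true for every resolution `R`: under the hypotheses of
  `Step4_Barrier R`, `Y t ≤ max (Y 0) (C²δ²)` on `[0,T)` (continuity at `t = 0` replaces the missing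
  derivative there);
* `step4_holds_of_grain` — the printed Step 4 holds exactly in the regime where the printed level dominates
  the true one, `C = 0 ∨ δ ≤ 1/4` (then `C²δ² ≤ C²δ/4`). For `C ≠ 0`, `δ > 1/4` the printed statement fails at
  the function grain (an affine `Y` started strictly between the two levels) — refuter's by-slot material,
  not built here.

Salvage seat `ns-claims-salvage-p1` g3 (solo lane; no statement item).

WHAT THIS IS NOT: not a claim about NS regularity or blow-up; not a claim about any author beyond the typed
locator.
-/

set_option linter.dupNamespace false

noncomputable section

open Set Filter Topology

namespace Summit.NavierStokesRegularity.NavierStokesRegularity.Theorems.Guevremont2026Salvage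

open Literature.Claims.NS.Guevremont2026 (Resolution law)

/-- **The corrected threshold**: for `y ≥ C²δ²` (`y ≥ 0`, `δ > 0`) the right-hand side of the enstrophy law
is non-positive, `C·y√y − y²/δ ≤ 0`. [cite: Guevremont2026, §4.1–§4.2 p.5 l.54–74] -/
theorem law_nonpos_of_ge (R : Resolution) {y : ℝ} (hy0 : 0 ≤ y) (hy : R.C ^ 2 * R.δ ^ 2 ≤ y) :
    law R y ≤ 0 := by
  have hδ := R.δ_pos
  unfold Literature.Claims.NS.Guevremont2026.law
  -- `|C| δ ≤ √y`
  have hs : |R.C| * R.δ ≤ Real.sqrt y := by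
    rw [← Real.sqrt_sq (mul_nonneg (abs_nonneg _) hδ.le)]
    exact Real.sqrt_le_sqrt (by rw [mul_pow, sq_abs]; exact hy)
  have hsq : Real.sqrt y * Real.sqrt y = y := Real.mul_self_sqrt hy0
  have h1 : R.C * (y * Real.sqrt y) ≤ |R.C| * (y * Real.sqrt y) :=
    mul_le_mul_of_nonneg_right (le_abs_self _) (mul_nonneg hy0 (Real.sqrt_nonneg _))
  have h2 : |R.C| * (y * Real.sqrt y) ≤ y ^ 2 / R.δ := by
    rw [le_div_iff₀ hδ]
    calc |R.C| * (y * Real.sqrt y) * R.δ = (|R.C| * R.δ) * Real.sqrt y * y := by ring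
      _ ≤ Real.sqrt y * Real.sqrt y * y :=
          mul_le_mul_of_nonneg_right (mul_le_mul_of_nonneg_right hs (Real.sqrt_nonneg _)) hy0
      _ = y ^ 2 := by rw [hsq]; ring
  linarith

/-- **Barrier principle** («standard ODE comparison»): a function continuous on `[a,b]` with right derivatives
on `[a,b)` that are `≤ 0` wherever the function exceeds `K` satisfies `f x ≤ max (f a) K` on `[a,b]`.
[cite: Guevremont2026, §4.2 p.5 l.67–74] -/
theorem le_max_of_deriv_right_nonpos_above {f f' : ℝ → ℝ} {a b K : ℝ} (hf : ContinuousOn f (Icc a b))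
    (hf' : ∀ x ∈ Ico a b, HasDerivWithinAt f (f' x) (Ici x) x)
    (hneg : ∀ x ∈ Ico a b, K < f x → f' x ≤ 0) :
    ∀ x ∈ Icc a b, f x ≤ max (f a) K := by
  intro x hx
  set M := max (f a) K with hM
  -- compare with the affine barriers `B_ε(y) = M + ε + ε (y - a)`, `ε > 0`
  have key : ∀ ε : ℝ, 0 < ε → f x ≤ M + ε + ε * (x - a) := by
    intro ε hε
    have hB : ContinuousOn (fun y => M + ε + ε * (y - a)) (Icc a b) := by fun_prop
    have hB' : ∀ y ∈ Ico a b, HasDerivWithinAt (fun y => M + ε + ε * (y - a)) ε (Ici y) y := by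
      intro y _
      have h : HasDerivAt (fun y => M + ε + ε * (y - a)) ε y := by
        simpa using ((hasDerivAt_id y).sub_const a).const_mul ε |>.const_add (M + ε)
      exact h.hasDerivWithinAt
    refine image_le_of_deriv_right_lt_deriv_boundary' hf hf' (by
      show f a ≤ M + ε + ε * (a - a)
      simp only [sub_self, mul_zero, add_zero]; linarith [le_max_left (f a) K]) hB hB' ?_ hx
    intro y hy hyeq
    have hfy : K < f y := by
      rw [hyeq]
      have : 0 ≤ ε * (y - a) := mul_nonneg hε.le (sub_nonneg.2 hy.1)
      linarith [le_max_right (f a) K]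
    exact lt_of_le_of_lt (hneg y hy hfy) hε
  -- let `ε → 0`
  by_contra h
  push Not at h
  have hgap : 0 < f x - M := sub_pos.2 h
  have hxa : 0 ≤ x - a := sub_nonneg.2 hx.1
  have hε : 0 < (f x - M) / (2 * (1 + (x - a))) := by positivity
  have hkey := key _ hε
  have h1 : (f x - M) / (2 * (1 + (x - a))) * (1 + (x - a)) = (f x - M) / 2 := by
    field_simp
  nlinarith [h1]

/-- **Step 4 of C143, CORRECTED threshold** — true for every resolution `R`: a non-negative `Y`, continuous
on `[0,T)` and differentiable on `(0,T)` with `Y′ ≤ C·Y√Y − Y²/δ` there, satisfies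
`Y(t) ≤ max(Y(0), C²δ²)` on `[0,T)` (the level where the right-hand side changes sign; the printed level is
`C²δ/4`). [cite: Guevremont2026, §4.2 p.5 l.67–74] -/
theorem barrier_corrected (R : Resolution) (Y : ℝ → ℝ) (T : ℝ) (hcont : ContinuousOn Y (Ico 0 T))
    (hnn : ∀ t ∈ Ico 0 T, 0 ≤ Y t)
    (hder : ∀ t ∈ Ioo 0 T, DifferentiableAt ℝ Y t ∧ deriv Y t ≤ law R (Y t)) :
    ∀ t ∈ Ico 0 T, Y t ≤ max (Y 0) (R.C ^ 2 * R.δ ^ 2) := by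
  intro t ht
  set K := R.C ^ 2 * R.δ ^ 2 with hK
  -- on every `[a', t]` with `0 < a'` the barrier principle applies
  have step : ∀ a' : ℝ, 0 < a' → a' ≤ t → Y t ≤ max (Y a') K := by
    intro a' ha' ha't
    have hsub : Icc a' t ⊆ Ico 0 T := fun s hs => ⟨ha'.le.trans hs.1, lt_of_le_of_lt hs.2 ht.2⟩
    refine le_max_of_deriv_right_nonpos_above (f' := deriv Y) (hcont.mono hsub)
      (fun x hx => ?_) (fun x hx hKx => ?_) t (right_mem_Icc.2 ha't)
    · have hxI : x ∈ Ioo 0 T := ⟨ha'.trans_le hx.1, hx.2.trans ht.2⟩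
      exact ((hder x hxI).1.hasDerivAt).hasDerivWithinAt
    · have hxI : x ∈ Ioo 0 T := ⟨ha'.trans_le hx.1, hx.2.trans ht.2⟩
      exact (hder x hxI).2.trans (law_nonpos_of_ge R (hnn x ⟨hxI.1.le, hxI.2⟩) hKx.le)
  -- let `a' → 0⁺`, using continuity of `Y` at `0` within `[0,T)`
  rcases eq_or_lt_of_le ht.1 with h0 | h0
  · rw [← h0]; exact le_max_left _ _
  by_contra hc
  push Not at hc
  have hYt : K < Y t := lt_of_le_of_lt (le_max_right _ _) hc
  have hY0 : Y 0 < Y t := lt_of_le_of_lt (le_max_left _ _) hc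
  -- every `a' ∈ (0, t]` has `Y a' ≥ Y t`
  have hge : ∀ a' : ℝ, 0 < a' → a' ≤ t → Y t ≤ Y a' := by
    intro a' ha' ha't
    have h := step a' ha' ha't
    rcases le_max_iff.1 h with h1 | h2
    · exact h1
    · exact absurd h2 (not_le.2 hYt)
  -- continuity at `0` within `[0,T)` gives `a'` with `Y a' < Y t`
  have hc0 : ContinuousWithinAt Y (Ico 0 T) 0 := hcont 0 ⟨le_rfl, h0.trans ht.2⟩
  rw [Metric.continuousWithinAt_iff] at hc0
  obtain ⟨η, hη, hclose⟩ := hc0 (Y t - Y 0) (sub_pos.2 hY0)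
  set a' := min (η / 2) t with ha'
  have ha'pos : 0 < a' := lt_min (half_pos hη) h0
  have ha't : a' ≤ t := min_le_right _ _
  have ha'η : dist a' 0 < η := by
    rw [dist_zero_right, Real.norm_of_nonneg ha'pos.le]
    exact lt_of_le_of_lt (min_le_left _ _) (half_lt_self hη)
  have h1 := hclose (show a' ∈ Ico 0 T from ⟨ha'pos.le, lt_of_le_of_lt ha't ht.2⟩) ha'η
  rw [Real.dist_eq] at h1
  have h2 := hge a' ha'pos ha't
  have h3 : Y a' - Y 0 < Y t - Y 0 := lt_of_le_of_lt (le_abs_self _) h1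
  linarith

/-- **The printed Step 4 holds in the regime `C = 0 ∨ δ ≤ 1/4`** (there `C²δ² ≤ C²δ/4`, so the corrected
bound implies the printed one). [cite: Guevremont2026, §4.2 p.5 l.67–74] -/
theorem step4_holds_of_grain (R : Resolution) (hR : R.C = 0 ∨ R.δ ≤ 1 / 4) :
    Literature.Claims.NS.Guevremont2026.Step4_Barrier R := by
  intro Y T hcont hnn hder t ht
  have hδ := R.δ_pos
  have hle : R.C ^ 2 * R.δ ^ 2 ≤ R.C ^ 2 * R.δ / 4 := by
    rcases hR with hC | hd
    · simp [hC]
    · have hC2 : 0 ≤ R.C ^ 2 := sq_nonneg _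
      calc R.C ^ 2 * R.δ ^ 2 = (R.C ^ 2 * R.δ) * R.δ := by ring
        _ ≤ (R.C ^ 2 * R.δ) * (1 / 4) := mul_le_mul_of_nonneg_left hd (mul_nonneg hC2 hδ.le)
        _ = R.C ^ 2 * R.δ / 4 := by ring
  exact (barrier_corrected R Y T hcont hnn hder t ht).trans (max_le_max le_rfl hle)

end Summit.NavierStokesRegularity.NavierStokesRegularity.Theorems.Guevremont2026Salvage

end
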